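import Mathlib
import Summits.Ventures.PercRepro2.PMK5Deg5LocusCnt

/-!
# THE COUNT TREE SPLIT AT ITS THREE OUTERMOST EDGES (blind cell PercRepro2, mine-2 g32)

A twelve-edge face has `4096` configurations; the kernel count of its nineteen tables in ONE `decide +kernel`
exceeds the verify nodes' memory cap (the kernel caches every closure step of every configuration).  `cnt1E T M a b c`
is the count tree started after the edges `14`, `13`, `12` are fixed to `a`, `b`, `c` (`512` leaves on a twelve-edge
face), and **`cnt1_eq_eighths`** is the tree's own first three unfoldings: `cnt1 T M` is the sum of the eighths that
the edge set allows.  The faces files `PMK5Deg5LocusFaces3–6` compute the eighths one `decide +kernel` each.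
Standard axioms.
-/

namespace Summit.Ventures.PercRepro2

namespace Deg5

namespace Locus

/-- The configuration with the edges `14`, `13`, `12` at `a`, `b`, `c` and every other edge closed. -/
def ω3 (a b c : Bool) : Fin 15 → Bool :=
  Function.update (Function.update (Function.update (fun _ => false) (Fin.ofNat 15 14) a) (Fin.ofNat 15 13) b)
    (Fin.ofNat 15 12) c

/-- The count tree of the eighth `(a, b, c)`: the edges `14`, `13`, `12` fixed, the edges `< 12` free. -/
def cnt1E (T : (Fin 15 → Bool) → Bool) (M : ℕ) (a b c : Bool) : ℕ := go1 T M 12 (ω3 a b c)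

/-- One unfolding of the tree at the edge `14`. -/
lemma go1_15 (T : (Fin 15 → Bool) → Bool) (M : ℕ) (ω : Fin 15 → Bool) :
    go1 T M 15 ω = go1 T M 14 (Function.update ω (Fin.ofNat 15 14) false) +
      (if M.testBit 14 then go1 T M 14 (Function.update ω (Fin.ofNat 15 14) true) else 0) := rfl

/-- One unfolding of the tree at the edge `13`. -/
lemma go1_14 (T : (Fin 15 → Bool) → Bool) (M : ℕ) (ω : Fin 15 → Bool) :
    go1 T M 14 ω = go1 T M 13 (Function.update ω (Fin.ofNat 15 13) false) +
      (if M.testBit 13 then go1 T M 13 (Function.update ω (Fin.ofNat 15 13) true) else 0) := rfl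

/-- One unfolding of the tree at the edge `12`. -/
lemma go1_13 (T : (Fin 15 → Bool) → Bool) (M : ℕ) (ω : Fin 15 → Bool) :
    go1 T M 13 ω = go1 T M 12 (Function.update ω (Fin.ofNat 15 12) false) +
      (if M.testBit 12 then go1 T M 12 (Function.update ω (Fin.ofNat 15 12) true) else 0) := rfl

/-- **The count is the sum of its eighths** (the tree's first three unfoldings). -/
lemma cnt1_eq_eighths (T : (Fin 15 → Bool) → Bool) (M : ℕ) :
    cnt1 T M =
      (cnt1E T M false false false + (if M.testBit 12 then cnt1E T M false false true else 0) +
        (if M.testBit 13 then cnt1E T M false true false +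
          (if M.testBit 12 then cnt1E T M false true true else 0) else 0)) +
      (if M.testBit 14 then
        (cnt1E T M true false false + (if M.testBit 12 then cnt1E T M true false true else 0) +
          (if M.testBit 13 then cnt1E T M true true false +
            (if M.testBit 12 then cnt1E T M true true true else 0) else 0))
      else 0) := by
  unfold cnt1 cnt1E ω3
  rw [go1_15, go1_14, go1_14, go1_13, go1_13, go1_13, go1_13]

end Locus

end Deg5

end Summit.Ventures.PercRepro2
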